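/-
Copyright (c) 2026 the pub-hodgecm-mathlib formalisation cell (harness21).  Prover seat hodgecm-mathlib-K2E3-p12 (g4), Track B «K2-LIT» ∕ h413
(`stmt-HodgeConjecture-24833`), line `K2_E3_EllipticInputs`, unit U12-d, §L (Φ′-d, part 1): THE (L-B_U)′ BODY IS INVARIANT UNDER A CHANGE OF FORM `J ↦ ᵗ(σP)·J·P`.
2026-09-04.
-/
import Summits.HodgeConjecture.HodgeConjecture.Theorems.K2E3U2LieTraceCoordinates        -- ★ K2E3-p16: `exists_addEquiv_lieOfForm_of_congr'` (the chart `Y ↦ P⁻¹YP : 𝔲(σ,J) ≃ 𝔲(σ, ᵗ(σP)JP)`)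
import Literature.NumberTheory.Automorphic.UnitaryGroupFormTransport                       -- ★ `formCongr`, `conj_mem_unitaryGroupOfForm` (`g ∈ U(ᵗ(σP)JP) ⇒ PgP⁻¹ ∈ U(J)`)
import Literature.NumberTheory.Rogawski1990.LocalTransferFundamentalLemma                   -- ★ `IsLocSmooth`
import Mathlib.MeasureTheory.Function.LocallyIntegrable
import Mathlib.MeasureTheory.Measure.Haar.Unique
import HarnessLib

/-!
# K2_E3 road (h413), §L — (Φ′-d, part 1): Fourier regularity of `J(𝒩)`-distributions on `𝔲(σ, J)` is a CONGRUENCE INVARIANT of `J`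

Cell `pub/hodgecm-mathlib` (D-0151), Track B, seat K2E3-p12 (g4), §L line lead (MEMO v3, road «U-iso-T»).  `--supports stmt-HodgeConjecture-24833 --as helper`;
count-neutral plumbing toward the hosted socket (L-B_U)′ `sig_K2E3UNilpotentFourierRegular` (U12 ED. 7 :373).

For `P ∈ GL_N(R)` the chart `κ : Y ↦ P⁻¹YP` is a bi-continuous additive isomorphism `𝔲(σ, J) ≃ 𝔲(σ, J′)`, `J′ = ᵗ(σP)·J·P = formCongr σ P J` (★ K2E3-p16
`exists_addEquiv_lieOfForm_of_congr'`), intertwining `Ad(PgP⁻¹)` on `𝔲(σ,J)` with `Ad(g)` on `𝔲(σ,J′)` for `g ∈ U(σ,J′)` (★ `conj_mem_unitaryGroupOfForm`), preserving the trace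
pairing, nilpotency and characteristic polynomials.  Hence:

* §1 `transport_isLocSmooth`, `transport_clauses` — if `T` satisfies the four `J(𝒩)` clauses on `𝔲(σ,J)` ((i) additive, (ii) homogeneous, (iii) `Ad U(σ,J)`-invariant, (iv) kills
  `f` with `tsupport f ∩ 𝒩 = ∅`), then `T′ f′ := T(f′ ∘ κ)` satisfies them on `𝔲(σ,J′)`.
* §2 `lieFourier_congr` — `𝓕_J f = (𝓕_{J′} (f ∘ κ⁻¹)) ∘ κ` for the transported measure `κ_*μ` (`tr(P⁻¹YP·P⁻¹XP) = tr(YX)`).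
* §3 **`nilpotentFourierRegular_of_formCongr`** — THE HEAD: the full (L-B_U)′ body «every Haar `μ`, every `T ∈ J(𝒩)` ⟹ `∃ Fn` locally integrable representing `T ∘ 𝓕` with local
  constancy on `{disc ∈ Rˣ}` and `ω(disc)·‖Fn‖` locally bounded» for `(σ, J′)` implies the same body for `(σ, J)`; any `ψ : R → ℂ`, any weight `ω : R → ℝ`.
  USE (next file): at `N = 2` an ISOTROPIC hermitian `H_w` is congruent to `J₀ = antidiag(1,1)`, where ★ p857242 `K2E3U11NilpotentInvariantTransport` reads the body on `𝔤𝔩₂(L⁺_v)`.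

HONEST LABEL: HC_CM is proved only modulo the 7 printed citations (2 remaining named inputs: hLiu418 = stmt-HodgeConjecture-24832, h413 = stmt-HodgeConjecture-24833)
until rung 0 closes; count-neutral plumbing.

References: [HarishChandra1999AdmissibleDistributions] Harish-Chandra (DeBacker–Sally), *Admissible Invariant Distributions on Reductive p-adic Groups* (1999), Thm. 4.4 p. 11,
§21 p. 87; [PlatonovRapinchuk1994] Platonov–Rapinchuk, *Algebraic Groups and Number Theory* (1994), §2.3; [Folland1995] Folland, *A Course in Abstract Harmonic Analysis* (1995),
§2.2 Thm. 2.20; [Knapp2002] Knapp, *Lie Groups Beyond an Introduction* (2002), I §1.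
-/

set_option autoImplicit false
set_option linter.dupNamespace false   -- `Summit.HodgeConjecture.HodgeConjecture.…` (D-0017 nested layout; lakefile exemption for Summits)

noncomputable section

open MeasureTheory Measure Filter Topology
open scoped Matrix MatrixGroups
open Literature.NumberTheory.Rogawski1990 Literature.NumberTheory.Automorphic
open Summit.HodgeConjecture.HodgeConjecture.Cruxes.H413.K2E3LieUnitary (lieOfForm mem_lieOfForm_iff conj_mem_lieOfForm lieFourier lieFourier_apply)
open Summit.HodgeConjecture.HodgeConjecture.Cruxes.H413.K2E3U2LieTraceCoordinates (exists_addEquiv_lieOfForm_of_congr')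

namespace Summit.HodgeConjecture.HodgeConjecture.Cruxes.H413.K2E3LieUnitaryNilpotentFourierRegularCongr

variable {R : Type*} [Field R] [TopologicalSpace R] [IsTopologicalRing R] (σ : R →+* R) {N : ℕ} (J : Matrix (Fin N) (Fin N) R) (P : GL (Fin N) R)

/-! ## §0  The chart `κ : Y ↦ P⁻¹YP` and its algebra -/

/-- **The change-of-form chart** `κ : 𝔲(σ,J) ≃+ 𝔲(σ, ᵗ(σP)JP)`, `κ Y = P⁻¹YP`, bi-continuous (★ K2E3-p16 `exists_addEquiv_lieOfForm_of_congr'` at `e = id`).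
[cite: PlatonovRapinchuk1994, §2.3] -/
theorem exists_chart :
    ∃ κ : ↥(lieOfForm σ J) ≃+ ↥(lieOfForm σ (((P : Matrix (Fin N) (Fin N) R).map σ)ᵀ * J * (P : Matrix (Fin N) (Fin N) R))), Continuous κ ∧ Continuous κ.symm ∧
      ∀ Y : ↥(lieOfForm σ J), (κ Y).1 = ((P⁻¹ : GL (Fin N) R) : Matrix (Fin N) (Fin N) R) * Y.1 * (P : Matrix (Fin N) (Fin N) R) := by
  obtain ⟨κ, hκ, hκs, hκf⟩ := exists_addEquiv_lieOfForm_of_congr' σ P J (AddEquiv.refl ↥(lieOfForm σ (((P : Matrix (Fin N) (Fin N) R).map σ)ᵀ * J * (P : Matrix (Fin N) (Fin N) R)))) continuous_id continuous_id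
  refine ⟨κ, hκ, hκs, fun Y => ?_⟩
  obtain ⟨hY, hκY⟩ := hκf Y
  rw [hκY]
  rfl

omit [TopologicalSpace R] [IsTopologicalRing R] in
/-- The inverse chart: `(κ⁻¹ X′) = P·X′·P⁻¹`. [cite: PlatonovRapinchuk1994, §2.3] -/
theorem chart_symm_apply (κ : ↥(lieOfForm σ J) ≃+ ↥(lieOfForm σ (((P : Matrix (Fin N) (Fin N) R).map σ)ᵀ * J * (P : Matrix (Fin N) (Fin N) R))))
    (hκ : ∀ Y : ↥(lieOfForm σ J), (κ Y).1 = ((P⁻¹ : GL (Fin N) R) : Matrix (Fin N) (Fin N) R) * Y.1 * (P : Matrix (Fin N) (Fin N) R)) (X' : ↥(lieOfForm σ (((P : Matrix (Fin N) (Fin N) R).map σ)ᵀ * J * (P : Matrix (Fin N) (Fin N) R)))) :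
    (κ.symm X').1 = (P : Matrix (Fin N) (Fin N) R) * X'.1 * ((P⁻¹ : GL (Fin N) R) : Matrix (Fin N) (Fin N) R) := by
  have h := hκ (κ.symm X')
  rw [AddEquiv.apply_symm_apply] at h
  have hPP : (P : Matrix (Fin N) (Fin N) R) * ((P⁻¹ : GL (Fin N) R) : Matrix (Fin N) (Fin N) R) = 1 := by
    rw [← Units.val_mul, mul_inv_cancel, Units.val_one]
  calc (κ.symm X').1 = ((P : Matrix (Fin N) (Fin N) R) * ((P⁻¹ : GL (Fin N) R) : Matrix (Fin N) (Fin N) R)) * (κ.symm X').1 * ((P : Matrix (Fin N) (Fin N) R) * ((P⁻¹ : GL (Fin N) R) : Matrix (Fin N) (Fin N) R)) := by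
        rw [hPP, Matrix.one_mul, Matrix.mul_one]
    _ = (P : Matrix (Fin N) (Fin N) R) * (((P⁻¹ : GL (Fin N) R) : Matrix (Fin N) (Fin N) R) * (κ.symm X').1 * (P : Matrix (Fin N) (Fin N) R)) * ((P⁻¹ : GL (Fin N) R) : Matrix (Fin N) (Fin N) R) := by
        simp only [Matrix.mul_assoc]
    _ = (P : Matrix (Fin N) (Fin N) R) * X'.1 * ((P⁻¹ : GL (Fin N) R) : Matrix (Fin N) (Fin N) R) := by rw [← h]

omit [TopologicalSpace R] [IsTopologicalRing R] in
/-- `tr(P⁻¹YP · P⁻¹XP) = tr(Y·X)`. [folklore] -/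
theorem trace_chart_mul_chart (Y X : Matrix (Fin N) (Fin N) R) :
    Matrix.trace ((((P⁻¹ : GL (Fin N) R) : Matrix (Fin N) (Fin N) R) * Y * (P : Matrix (Fin N) (Fin N) R)) * (((P⁻¹ : GL (Fin N) R) : Matrix (Fin N) (Fin N) R) * X * (P : Matrix (Fin N) (Fin N) R))) = Matrix.trace (Y * X) := by
  have hPP : (P : Matrix (Fin N) (Fin N) R) * ((P⁻¹ : GL (Fin N) R) : Matrix (Fin N) (Fin N) R) = 1 := by
    rw [← Units.val_mul, mul_inv_cancel, Units.val_one]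
  calc Matrix.trace ((((P⁻¹ : GL (Fin N) R) : Matrix (Fin N) (Fin N) R) * Y * (P : Matrix (Fin N) (Fin N) R)) * (((P⁻¹ : GL (Fin N) R) : Matrix (Fin N) (Fin N) R) * X * (P : Matrix (Fin N) (Fin N) R)))
      = Matrix.trace (((P⁻¹ : GL (Fin N) R) : Matrix (Fin N) (Fin N) R) * (Y * ((P : Matrix (Fin N) (Fin N) R) * ((P⁻¹ : GL (Fin N) R) : Matrix (Fin N) (Fin N) R)) * X) * (P : Matrix (Fin N) (Fin N) R)) := by
        simp only [Matrix.mul_assoc]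
    _ = Matrix.trace (Y * X) := by rw [hPP, Matrix.mul_one, Matrix.trace_mul_cycle, hPP, Matrix.one_mul]

omit [TopologicalSpace R] [IsTopologicalRing R] in
/-- `Ad(g) ∘ κ = κ ∘ Ad(PgP⁻¹)` on matrices: `g·(P⁻¹YP)·g⁻¹ = P⁻¹·((PgP⁻¹)·Y·(PgP⁻¹)⁻¹)·P`. [folklore] -/
theorem conj_chart (g : GL (Fin N) R) (Y : Matrix (Fin N) (Fin N) R) :
    (g : Matrix (Fin N) (Fin N) R) * (((P⁻¹ : GL (Fin N) R) : Matrix (Fin N) (Fin N) R) * Y * (P : Matrix (Fin N) (Fin N) R)) * ((g⁻¹ : GL (Fin N) R) : Matrix (Fin N) (Fin N) R) =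
      ((P⁻¹ : GL (Fin N) R) : Matrix (Fin N) (Fin N) R) * (((P * g * P⁻¹ : GL (Fin N) R) : Matrix (Fin N) (Fin N) R) * Y * (((P * g * P⁻¹)⁻¹ : GL (Fin N) R) : Matrix (Fin N) (Fin N) R)) * (P : Matrix (Fin N) (Fin N) R) := by
  have hPP' : ((P⁻¹ : GL (Fin N) R) : Matrix (Fin N) (Fin N) R) * (P : Matrix (Fin N) (Fin N) R) = 1 := by
    rw [← Units.val_mul, inv_mul_cancel, Units.val_one]
  rw [show (((P * g * P⁻¹)⁻¹ : GL (Fin N) R) : Matrix (Fin N) (Fin N) R) = (P : Matrix (Fin N) (Fin N) R) * ((g⁻¹ : GL (Fin N) R) : Matrix (Fin N) (Fin N) R) * ((P⁻¹ : GL (Fin N) R) : Matrix (Fin N) (Fin N) R) by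
      rw [mul_inv_rev, mul_inv_rev, inv_inv, Units.val_mul, Units.val_mul, mul_assoc],
    Units.val_mul, Units.val_mul]
  calc (g : Matrix (Fin N) (Fin N) R) * (((P⁻¹ : GL (Fin N) R) : Matrix (Fin N) (Fin N) R) * Y * (P : Matrix (Fin N) (Fin N) R)) * ((g⁻¹ : GL (Fin N) R) : Matrix (Fin N) (Fin N) R)
      = (((P⁻¹ : GL (Fin N) R) : Matrix (Fin N) (Fin N) R) * (P : Matrix (Fin N) (Fin N) R)) * (g : Matrix (Fin N) (Fin N) R) * (((P⁻¹ : GL (Fin N) R) : Matrix (Fin N) (Fin N) R) * Y * (P : Matrix (Fin N) (Fin N) R)) * ((g⁻¹ : GL (Fin N) R) : Matrix (Fin N) (Fin N) R) *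
          (((P⁻¹ : GL (Fin N) R) : Matrix (Fin N) (Fin N) R) * (P : Matrix (Fin N) (Fin N) R)) := by rw [hPP', Matrix.one_mul, Matrix.mul_one]
    _ = ((P⁻¹ : GL (Fin N) R) : Matrix (Fin N) (Fin N) R) * ((P : Matrix (Fin N) (Fin N) R) * (g : Matrix (Fin N) (Fin N) R) * ((P⁻¹ : GL (Fin N) R) : Matrix (Fin N) (Fin N) R) * Y *
          ((P : Matrix (Fin N) (Fin N) R) * ((g⁻¹ : GL (Fin N) R) : Matrix (Fin N) (Fin N) R) * ((P⁻¹ : GL (Fin N) R) : Matrix (Fin N) (Fin N) R))) * (P : Matrix (Fin N) (Fin N) R) := by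
        simp only [Matrix.mul_assoc]

/-! ## §1  The four `J(𝒩)` clauses through `κ` -/

section Clauses

variable (κ : ↥(lieOfForm σ J) ≃+ ↥(lieOfForm σ (((P : Matrix (Fin N) (Fin N) R).map σ)ᵀ * J * (P : Matrix (Fin N) (Fin N) R)))) (hκc : Continuous κ) (hκs : Continuous κ.symm)
  (hκ : ∀ Y : ↥(lieOfForm σ J), (κ Y).1 = ((P⁻¹ : GL (Fin N) R) : Matrix (Fin N) (Fin N) R) * Y.1 * (P : Matrix (Fin N) (Fin N) R))
  (T : (↥(lieOfForm σ J) → ℂ) → ℂ)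

omit [IsTopologicalRing R] in
include hκc hκs in
/-- `f′ ∘ κ ∈ C_c^∞(𝔲(σ,J))` for `f′ ∈ C_c^∞(𝔲(σ,J′))`. [cite: Rogawski1990, §1.6 p. 6] -/
theorem transport_isLocSmooth {f' : ↥(lieOfForm σ (((P : Matrix (Fin N) (Fin N) R).map σ)ᵀ * J * (P : Matrix (Fin N) (Fin N) R))) → ℂ} (hf' : IsLocSmooth f') : IsLocSmooth (fun Y => f' (κ Y)) :=
  let e : ↥(lieOfForm σ J) ≃ₜ ↥(lieOfForm σ (((P : Matrix (Fin N) (Fin N) R).map σ)ᵀ * J * (P : Matrix (Fin N) (Fin N) R))) := { toEquiv := κ.toEquiv, continuous_toFun := hκc, continuous_invFun := hκs }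
  ⟨hf'.1.comp_continuous e.continuous, hf'.2.comp_homeomorph e⟩

omit [IsTopologicalRing R] in
include hκc hκs in
/-- `f ∘ κ⁻¹ ∈ C_c^∞(𝔲(σ,J′))` for `f ∈ C_c^∞(𝔲(σ,J))`. [cite: Rogawski1990, §1.6 p. 6] -/
theorem transport_isLocSmooth_symm {f : ↥(lieOfForm σ J) → ℂ} (hf : IsLocSmooth f) : IsLocSmooth (fun X' => f (κ.symm X')) :=
  let e : ↥(lieOfForm σ J) ≃ₜ ↥(lieOfForm σ (((P : Matrix (Fin N) (Fin N) R).map σ)ᵀ * J * (P : Matrix (Fin N) (Fin N) R))) := { toEquiv := κ.toEquiv, continuous_toFun := hκc, continuous_invFun := hκs }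
  ⟨hf.1.comp_continuous e.symm.continuous, hf.2.comp_homeomorph e.symm⟩

omit [IsTopologicalRing R] in
include hκc hκs hκ in
/-- **THE FOUR CLAUSES TRANSPORT**: if `T ∈ J(𝒩)(𝔲(σ,J))` then `T′ f′ := T(f′ ∘ κ)` lies in `J(𝒩)(𝔲(σ, ᵗ(σP)JP))` — (iii) through `Ad(g)∘κ = κ∘Ad(PgP⁻¹)` and ★
`conj_mem_unitaryGroupOfForm`, (iv) because `κ` is conjugation (nilpotency) and a homeomorphism (`tsupport(f′∘κ) = κ⁻¹(tsupport f′)`).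
[cite: HarishChandra1999AdmissibleDistributions, Thm. 4.4 p. 11] [cite: PlatonovRapinchuk1994, §2.3] -/
theorem transport_clauses
    (hT : ((∀ f₁ f₂ : ↥(lieOfForm σ J) → ℂ, IsLocSmooth f₁ → IsLocSmooth f₂ → T (f₁ + f₂) = T f₁ + T f₂) ∧
         (∀ (a : ℂ) (f : ↥(lieOfForm σ J) → ℂ), IsLocSmooth f → T (a • f) = a * T f) ∧
         (∀ (x : ↥(unitaryGroupOfForm σ J)) (f : ↥(lieOfForm σ J) → ℂ), IsLocSmooth f →
            T (fun X => f ⟨((x : GL (Fin N) R) : Matrix (Fin N) (Fin N) R) * X.1 * (((x : GL (Fin N) R)⁻¹ : GL (Fin N) R) : Matrix (Fin N) (Fin N) R), conj_mem_lieOfForm x.2 X.2⟩) = T f) ∧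
         (∀ f : ↥(lieOfForm σ J) → ℂ, IsLocSmooth f → (∀ X ∈ tsupport f, ¬ IsNilpotent X.1) → T f = 0))) :
    ((∀ f₁ f₂ : ↥(lieOfForm σ (((P : Matrix (Fin N) (Fin N) R).map σ)ᵀ * J * (P : Matrix (Fin N) (Fin N) R))) → ℂ, IsLocSmooth f₁ → IsLocSmooth f₂ → (fun f' => T (fun Y => f' (κ Y))) (f₁ + f₂) = (fun f' => T (fun Y => f' (κ Y))) f₁ + (fun f' => T (fun Y => f' (κ Y))) f₂) ∧
         (∀ (a : ℂ) (f : ↥(lieOfForm σ (((P : Matrix (Fin N) (Fin N) R).map σ)ᵀ * J * (P : Matrix (Fin N) (Fin N) R))) → ℂ), IsLocSmooth f → (fun f' => T (fun Y => f' (κ Y))) (a • f) = a * (fun f' => T (fun Y => f' (κ Y))) f) ∧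
         (∀ (x : ↥(unitaryGroupOfForm σ (((P : Matrix (Fin N) (Fin N) R).map σ)ᵀ * J * (P : Matrix (Fin N) (Fin N) R)))) (f : ↥(lieOfForm σ (((P : Matrix (Fin N) (Fin N) R).map σ)ᵀ * J * (P : Matrix (Fin N) (Fin N) R))) → ℂ), IsLocSmooth f →
            (fun f' => T (fun Y => f' (κ Y))) (fun X => f ⟨((x : GL (Fin N) R) : Matrix (Fin N) (Fin N) R) * X.1 * (((x : GL (Fin N) R)⁻¹ : GL (Fin N) R) : Matrix (Fin N) (Fin N) R), conj_mem_lieOfForm x.2 X.2⟩) = (fun f' => T (fun Y => f' (κ Y))) f) ∧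
         (∀ f : ↥(lieOfForm σ (((P : Matrix (Fin N) (Fin N) R).map σ)ᵀ * J * (P : Matrix (Fin N) (Fin N) R))) → ℂ, IsLocSmooth f → (∀ X ∈ tsupport f, ¬ IsNilpotent X.1) → (fun f' => T (fun Y => f' (κ Y))) f = 0)) := by
  obtain ⟨hT1, hT2, hT3, hT4⟩ := hT
  let e : ↥(lieOfForm σ J) ≃ₜ ↥(lieOfForm σ (((P : Matrix (Fin N) (Fin N) R).map σ)ᵀ * J * (P : Matrix (Fin N) (Fin N) R))) := { toEquiv := κ.toEquiv, continuous_toFun := hκc, continuous_invFun := hκs }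
  refine ⟨fun f₁ f₂ h₁ h₂ => ?_, fun a f hf => ?_, fun x f hf => ?_, fun f hf hN => ?_⟩
  · exact hT1 _ _ (transport_isLocSmooth σ J P κ hκc hκs h₁) (transport_isLocSmooth σ J P κ hκc hκs h₂)
  · exact hT2 a _ (transport_isLocSmooth σ J P κ hκc hκs hf)
  · -- clause (iii): `x ∈ U(σ,J′)` gives `PxP⁻¹ ∈ U(σ,J)` and `κ(Ad(PxP⁻¹)Y) = Ad(x)(κY)`
    have hx : P * (x : GL (Fin N) R) * P⁻¹ ∈ unitaryGroupOfForm σ J := conj_mem_unitaryGroupOfForm σ P J x.2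
    have key := hT3 ⟨P * (x : GL (Fin N) R) * P⁻¹, hx⟩ (fun Y => f (κ Y)) (transport_isLocSmooth σ J P κ hκc hκs hf)
    refine Eq.trans ?_ key
    simp only
    congr 1
    funext Y
    congr 1
    apply Subtype.ext
    show ((x : GL (Fin N) R) : Matrix (Fin N) (Fin N) R) * (κ Y).1 * (((x : GL (Fin N) R)⁻¹ : GL (Fin N) R) : Matrix (Fin N) (Fin N) R) = (κ ⟨_, _⟩).1
    rw [hκ, hκ]
    exact conj_chart P (x : GL (Fin N) R) Y.1
  · -- clause (iv): `tsupport (f ∘ κ) = κ⁻¹(tsupport f)` and `κ` preserves nilpotency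
    refine hT4 _ (transport_isLocSmooth σ J P κ hκc hκs hf) fun Y hY hYn => ?_
    have hY' : κ Y ∈ tsupport f := by
      have h : tsupport (fun Y => f (e Y)) = e ⁻¹' tsupport f := by
        rw [tsupport, tsupport, e.preimage_closure]; congr 1
      exact (h ▸ hY : Y ∈ e ⁻¹' tsupport f)
    refine hN _ hY' ?_
    rw [hκ]
    obtain ⟨k, hk⟩ := hYn
    exact ⟨k, by rw [Units.conj_pow', hk, Matrix.mul_zero, Matrix.zero_mul]⟩

end Clauses

/-! ## §2  The Fourier transform through `κ` -/

section Fourier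

variable [MeasurableSpace ↥(lieOfForm σ J)] [BorelSpace ↥(lieOfForm σ J)] [MeasurableSpace ↥(lieOfForm σ (((P : Matrix (Fin N) (Fin N) R).map σ)ᵀ * J * (P : Matrix (Fin N) (Fin N) R)))] [BorelSpace ↥(lieOfForm σ (((P : Matrix (Fin N) (Fin N) R).map σ)ᵀ * J * (P : Matrix (Fin N) (Fin N) R)))]
  (κ : ↥(lieOfForm σ J) ≃+ ↥(lieOfForm σ (((P : Matrix (Fin N) (Fin N) R).map σ)ᵀ * J * (P : Matrix (Fin N) (Fin N) R)))) (hκc : Continuous κ) (hκs : Continuous κ.symm)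
  (hκ : ∀ Y : ↥(lieOfForm σ J), (κ Y).1 = ((P⁻¹ : GL (Fin N) R) : Matrix (Fin N) (Fin N) R) * Y.1 * (P : Matrix (Fin N) (Fin N) R))

omit [IsTopologicalRing R] in
include hκc hκs in
/-- Change of variables `X′ = κ X`: `∫ g(κ X) dμ = ∫ g dκ_*μ`. [cite: Folland1995, §2.2 Thm. 2.20] -/
theorem integral_comp_chart {G : Type*} [NormedAddCommGroup G] [NormedSpace ℝ G] (μ : Measure ↥(lieOfForm σ J)) (g : ↥(lieOfForm σ (((P : Matrix (Fin N) (Fin N) R).map σ)ᵀ * J * (P : Matrix (Fin N) (Fin N) R))) → G) :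
    ∫ X, g (κ X) ∂μ = ∫ X', g X' ∂(μ.map κ) := by
  let eH : ↥(lieOfForm σ J) ≃ₜ ↥(lieOfForm σ (((P : Matrix (Fin N) (Fin N) R).map σ)ᵀ * J * (P : Matrix (Fin N) (Fin N) R))) := { toEquiv := κ.toEquiv, continuous_toFun := hκc, continuous_invFun := hκs }
  have he : (eH.toMeasurableEquiv : ↥(lieOfForm σ J) → ↥(lieOfForm σ (((P : Matrix (Fin N) (Fin N) R).map σ)ᵀ * J * (P : Matrix (Fin N) (Fin N) R)))) = κ := rfl
  rw [← he, integral_map_equiv]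

omit [IsTopologicalRing R] in
include hκc hκs hκ in
/-- **`𝓕_J f = 𝓕_{J′}(f ∘ κ⁻¹) ∘ κ`** for the transported measure `κ_*μ`: the trace pairing is `Ad`-invariant (`tr(P⁻¹YP·P⁻¹XP) = tr(YX)`).
[cite: HarishChandra1999AdmissibleDistributions, Thm. 4.4 p. 11] [cite: Folland1995, §2.2 Thm. 2.20] -/
theorem lieFourier_congr (ψ : R → ℂ) (μ : Measure ↥(lieOfForm σ J)) (f : ↥(lieOfForm σ J) → ℂ) (Y : ↥(lieOfForm σ J)) :
    lieFourier σ J ψ μ f Y = lieFourier σ (((P : Matrix (Fin N) (Fin N) R).map σ)ᵀ * J * (P : Matrix (Fin N) (Fin N) R)) ψ (μ.map κ) (fun X' => f (κ.symm X')) (κ Y) := by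
  rw [lieFourier_apply, lieFourier_apply, ← integral_comp_chart σ J P κ hκc hκs μ]
  refine integral_congr_ae (Filter.Eventually.of_forall fun X => ?_)
  simp only [AddEquiv.symm_apply_apply]
  rw [hκ, hκ, trace_chart_mul_chart]

end Fourier

/-! ## §3  The head: the (L-B_U)′ body is a congruence invariant -/

section Head

variable [MeasurableSpace ↥(lieOfForm σ J)] [BorelSpace ↥(lieOfForm σ J)] [MeasurableSpace ↥(lieOfForm σ (((P : Matrix (Fin N) (Fin N) R).map σ)ᵀ * J * (P : Matrix (Fin N) (Fin N) R)))] [BorelSpace ↥(lieOfForm σ (((P : Matrix (Fin N) (Fin N) R).map σ)ᵀ * J * (P : Matrix (Fin N) (Fin N) R)))]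

/-- **THE (L-B_U)′ BODY IS INVARIANT UNDER `J ↦ ᵗ(σP)·J·P`.**  Fix `ψ : R → ℂ` and a weight `ω : R → ℝ`.  If for the form `J′ = ᵗ(σP)JP` every additive Haar measure `μ′` on
`𝔲(σ,J′)` and every `T′ ∈ J(𝒩)(𝔲(σ,J′))` (the four clauses) admit a `μ′`-locally-integrable `Fn′` with `T′(𝓕_{J′} f′) = ∫ f′·Fn′ dμ′` on `C_c^∞`, `Fn′` locally constant at every
`X′` with `disc X′ ∈ Rˣ`, and `ω(disc X′)·‖Fn′ X′‖` bounded on compacta — then the same holds for `J`: given `μ`, `T`, transport to `μ′ = κ_*μ` (Haar, `κ` a bi-continuous additive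
isomorphism), `T′ f′ = T(f′∘κ)` (★ `transport_clauses`), take `Fn = Fn′ ∘ κ` (★ `lieFourier_congr`; `χ_{P⁻¹XP} = χ_X`).  This is U12 ED. 7 :373's body, binders `μ𝔤, T` inwards,
for ANY `(R, σ, ψ, ω)`. [cite: HarishChandra1999AdmissibleDistributions, Thm. 4.4 p. 11, §21 p. 87] [cite: PlatonovRapinchuk1994, §2.3] [cite: Folland1995, §2.2 Thm. 2.20] -/
theorem nilpotentFourierRegular_of_formCongr (ψ : R → ℂ) (ω : R → ℝ)
    (hJ' : ∀ (μ' : Measure ↥(lieOfForm σ (((P : Matrix (Fin N) (Fin N) R).map σ)ᵀ * J * (P : Matrix (Fin N) (Fin N) R)))) [μ'.IsAddHaarMeasure] (T' : (↥(lieOfForm σ (((P : Matrix (Fin N) (Fin N) R).map σ)ᵀ * J * (P : Matrix (Fin N) (Fin N) R))) → ℂ) → ℂ),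
      ((∀ f₁ f₂ : ↥(lieOfForm σ (((P : Matrix (Fin N) (Fin N) R).map σ)ᵀ * J * (P : Matrix (Fin N) (Fin N) R))) → ℂ, IsLocSmooth f₁ → IsLocSmooth f₂ → T' (f₁ + f₂) = T' f₁ + T' f₂) ∧
         (∀ (a : ℂ) (f : ↥(lieOfForm σ (((P : Matrix (Fin N) (Fin N) R).map σ)ᵀ * J * (P : Matrix (Fin N) (Fin N) R))) → ℂ), IsLocSmooth f → T' (a • f) = a * T' f) ∧
         (∀ (x : ↥(unitaryGroupOfForm σ (((P : Matrix (Fin N) (Fin N) R).map σ)ᵀ * J * (P : Matrix (Fin N) (Fin N) R)))) (f : ↥(lieOfForm σ (((P : Matrix (Fin N) (Fin N) R).map σ)ᵀ * J * (P : Matrix (Fin N) (Fin N) R))) → ℂ), IsLocSmooth f →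
            T' (fun X => f ⟨((x : GL (Fin N) R) : Matrix (Fin N) (Fin N) R) * X.1 * (((x : GL (Fin N) R)⁻¹ : GL (Fin N) R) : Matrix (Fin N) (Fin N) R), conj_mem_lieOfForm x.2 X.2⟩) = T' f) ∧
         (∀ f : ↥(lieOfForm σ (((P : Matrix (Fin N) (Fin N) R).map σ)ᵀ * J * (P : Matrix (Fin N) (Fin N) R))) → ℂ, IsLocSmooth f → (∀ X ∈ tsupport f, ¬ IsNilpotent X.1) → T' f = 0)) →
        ∃ Fn : ↥(lieOfForm σ (((P : Matrix (Fin N) (Fin N) R).map σ)ᵀ * J * (P : Matrix (Fin N) (Fin N) R))) → ℂ, LocallyIntegrable Fn μ' ∧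
          (∀ f : ↥(lieOfForm σ (((P : Matrix (Fin N) (Fin N) R).map σ)ᵀ * J * (P : Matrix (Fin N) (Fin N) R))) → ℂ, IsLocSmooth f → T' (lieFourier σ (((P : Matrix (Fin N) (Fin N) R).map σ)ᵀ * J * (P : Matrix (Fin N) (Fin N) R)) ψ μ' f) = ∫ X, f X * Fn X ∂μ') ∧
          (∀ X : ↥(lieOfForm σ (((P : Matrix (Fin N) (Fin N) R).map σ)ᵀ * J * (P : Matrix (Fin N) (Fin N) R))), IsUnit X.1.charpoly.discr → ∀ᶠ Y in 𝓝 X, Fn Y = Fn X) ∧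
          (∀ C : Set ↥(lieOfForm σ (((P : Matrix (Fin N) (Fin N) R).map σ)ᵀ * J * (P : Matrix (Fin N) (Fin N) R))), IsCompact C → ∃ B : ℝ, ∀ X ∈ C, ω X.1.charpoly.discr * ‖Fn X‖ ≤ B))
    (μ : Measure ↥(lieOfForm σ J)) [μ.IsAddHaarMeasure] (T : (↥(lieOfForm σ J) → ℂ) → ℂ)
    (hT : ((∀ f₁ f₂ : ↥(lieOfForm σ J) → ℂ, IsLocSmooth f₁ → IsLocSmooth f₂ → T (f₁ + f₂) = T f₁ + T f₂) ∧
         (∀ (a : ℂ) (f : ↥(lieOfForm σ J) → ℂ), IsLocSmooth f → T (a • f) = a * T f) ∧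
         (∀ (x : ↥(unitaryGroupOfForm σ J)) (f : ↥(lieOfForm σ J) → ℂ), IsLocSmooth f →
            T (fun X => f ⟨((x : GL (Fin N) R) : Matrix (Fin N) (Fin N) R) * X.1 * (((x : GL (Fin N) R)⁻¹ : GL (Fin N) R) : Matrix (Fin N) (Fin N) R), conj_mem_lieOfForm x.2 X.2⟩) = T f) ∧
         (∀ f : ↥(lieOfForm σ J) → ℂ, IsLocSmooth f → (∀ X ∈ tsupport f, ¬ IsNilpotent X.1) → T f = 0))) :
    ∃ Fn : ↥(lieOfForm σ J) → ℂ, LocallyIntegrable Fn μ ∧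
          (∀ f : ↥(lieOfForm σ J) → ℂ, IsLocSmooth f → T (lieFourier σ J ψ μ f) = ∫ X, f X * Fn X ∂μ) ∧
          (∀ X : ↥(lieOfForm σ J), IsUnit X.1.charpoly.discr → ∀ᶠ Y in 𝓝 X, Fn Y = Fn X) ∧
          (∀ C : Set ↥(lieOfForm σ J), IsCompact C → ∃ B : ℝ, ∀ X ∈ C, ω X.1.charpoly.discr * ‖Fn X‖ ≤ B) := by
  obtain ⟨κ, hκc, hκs, hκ⟩ := exists_chart σ J P
  haveI : IsTopologicalAddGroup (Matrix (Fin N) (Fin N) R) := inferInstanceAs (IsTopologicalAddGroup (Fin N → Fin N → R))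
  haveI : (μ.map κ).IsAddHaarMeasure := AddEquiv.isAddHaarMeasure_map μ κ hκc hκs
  let eH : ↥(lieOfForm σ J) ≃ₜ ↥(lieOfForm σ (((P : Matrix (Fin N) (Fin N) R).map σ)ᵀ * J * (P : Matrix (Fin N) (Fin N) R))) := { toEquiv := κ.toEquiv, continuous_toFun := hκc, continuous_invFun := hκs }
  have he : (eH : ↥(lieOfForm σ J) → ↥(lieOfForm σ (((P : Matrix (Fin N) (Fin N) R).map σ)ᵀ * J * (P : Matrix (Fin N) (Fin N) R)))) = κ := rfl
  obtain ⟨Fn', hFn'i, hFn'T, hFn'c, hFn'b⟩ := hJ' (μ.map κ) (fun f' => T (fun Y => f' (κ Y))) (transport_clauses σ J P κ hκc hκs hκ T hT)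
  have hchar : ∀ X : ↥(lieOfForm σ J), (κ X).1.charpoly = X.1.charpoly := fun X => by
    rw [hκ, Matrix.coe_units_inv, Matrix.charpoly_units_conj']
  refine ⟨fun X => Fn' (κ X), ?_, fun f hf => ?_, fun X hX => ?_, fun C hC => ?_⟩
  · have h := (locallyIntegrable_map_homeomorph eH (f := Fn') (μ := μ)).1 (by rw [he]; exact hFn'i)
    rw [he] at h
    exact h
  · have hfs : IsLocSmooth (fun X' => f (κ.symm X')) := transport_isLocSmooth_symm σ J P κ hκc hκs hf
    have hfun : lieFourier σ J ψ μ f = fun Y => lieFourier σ (((P : Matrix (Fin N) (Fin N) R).map σ)ᵀ * J * (P : Matrix (Fin N) (Fin N) R)) ψ (μ.map κ) (fun X' => f (κ.symm X')) (κ Y) :=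
      funext fun Y => lieFourier_congr σ J P κ hκc hκs hκ ψ μ f Y
    rw [hfun, hFn'T _ hfs, ← integral_comp_chart σ J P κ hκc hκs μ (fun X' => f (κ.symm X') * Fn' X')]
    simp only [AddEquiv.symm_apply_apply]
  · have hX' : IsUnit (κ X).1.charpoly.discr := by rw [hchar]; exact hX
    exact (hκc.tendsto X).eventually (hFn'c _ hX')
  · obtain ⟨B, hB⟩ := hFn'b (κ '' C) (hC.image hκc)
    refine ⟨B, fun X hX => ?_⟩
    have := hB (κ X) ⟨X, hX, rfl⟩
    rwa [hchar] at this

end Head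

end Summit.HodgeConjecture.HodgeConjecture.Cruxes.H413.K2E3LieUnitaryNilpotentFourierRegularCongr

end
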